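import Mathlib
import HarnessLib
import Literature.Geometry.DiscreteGeometry.SphericalCodeHullEulerFormula

/-!
# Soft bonds are hull edges: the link graph lives in the convex-hull subdivision

Route `PricedLinkCensus`, item `SoftFourRings` (stmt-AtomisticToContinuum-14234), evidence
`softrings-search.md` §12.  The GLOBAL step of the blueprint (Euler's formula for the geodesic
drawing of the link graph) is served by the tree's face theory of spherical subdivisions
(`Literature.Geometry.DiscreteGeometry.SphericalCodeHullEuler*`: for a finite set `X ⊂ S²` of unit
vectors with `0 ∈ interior (conv X)`, `#hullEdges X + 2 = #X + #facets`, `#hullEdges X ≤ 3#X − 6`,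
Girard, cone tilings — all proved there).  This file supplies the bridge from the SOFT link graph:
in a window with `2 ca < 1 + cb` (at `η = 1/100`: `2·0.5099 < 1.49`), every soft bond
(`cb ≤ ⟪u, v⟫`) between `ca`-separated unit vectors spans an exposed edge of `conv X`, exposed by
the functional `(u + v)/(1 + ⟪u, v⟫)` exactly as a contact pair of a spherical code
(`pair_mem_hullEdges_of_contact`, the case `⟪u, v⟫ = κ = ca`).  Hence any family of soft-bond pairs
is a sub-family of `hullEdges X` (`subset_hullEdges_of_soft_bonds`) and, when `0` is interior to
the hull, numbers at most `3#X − 6` (`card_soft_bonds_le`); for a 4-regular twelve-point link this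
reads `24 ≤ #hullEdges X ≤ 30`: at most six hull edges are not bonds.  What the global step still
needs on top (not here): `0 ∈ interior (conv X)` for the twelve link directions (an area /
hemisphere argument), and the passage from hull facets to the faces of the link graph.
-/

namespace Summit.AtomisticToContinuum.Crystallization.Theorems

open Real RealInnerProductSpace Literature.Geometry.DiscreteGeometry

/-- **A soft bond spans a hull edge.**  Unit vectors `X`, distinct points at inner product `≤ ca`,
`−1 < cb`, `2 ca < 1 + cb`: if `u ≠ v` in `X` have `cb ≤ ⟪u, v⟫` then `{u, v} ∈ hullEdges X`,
exposed by `c₀ = (u + v)/(1 + ⟪u, v⟫)` (`⟪c₀, u⟫ = ⟪c₀, v⟫ = 1`, and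
`⟪c₀, y⟫ ≤ 2ca/(1 + ⟪u, v⟫) < 1` for every other `y ∈ X`). [folklore] -/
theorem pair_mem_hullEdges_of_soft_bond {X : Finset (EuclideanSpace ℝ (Fin 3))}
    (hX1 : ∀ y ∈ X, ‖y‖ = 1) {ca cb : ℝ} (hcb : -1 < cb) (h : 2 * ca < 1 + cb)
    (hsep : ∀ u ∈ X, ∀ v ∈ X, u ≠ v → ⟪u, v⟫ ≤ ca) {u v : EuclideanSpace ℝ (Fin 3)} (hu : u ∈ X)
    (hv : v ∈ X) (hne : u ≠ v) (huv : cb ≤ ⟪u, v⟫) :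
    ({u, v} : Finset (EuclideanSpace ℝ (Fin 3))) ∈ hullEdges X := by
  classical
  set κ := ⟪u, v⟫ with hκ
  have h1κ : 0 < 1 + κ := by linarith
  have huu : ⟪u, u⟫ = 1 := by rw [real_inner_self_eq_norm_sq, hX1 u hu]; norm_num
  have hvv : ⟪v, v⟫ = 1 := by rw [real_inner_self_eq_norm_sq, hX1 v hv]; norm_num
  set c₀ : EuclideanSpace ℝ (Fin 3) := (1 + κ)⁻¹ • (u + v) with hc₀
  have hc₀y : ∀ y, ⟪c₀, y⟫ = (1 + κ)⁻¹ * (⟪u, y⟫ + ⟪v, y⟫) := fun y => by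
    rw [hc₀, real_inner_smul_left, inner_add_left]
  have hc₀u : ⟪c₀, u⟫ = 1 := by
    rw [hc₀y, huu, real_inner_comm, ← hκ, inv_mul_cancel₀ h1κ.ne']
  have hc₀v : ⟪c₀, v⟫ = 1 := by
    rw [hc₀y, ← hκ, hvv, add_comm κ 1, inv_mul_cancel₀ h1κ.ne']
  have hlt : ∀ y ∈ X, y ≠ u → y ≠ v → ⟪c₀, y⟫ < 1 := by
    intro y hy hyu hyv
    rw [hc₀y, inv_mul_lt_iff₀ h1κ, mul_one]
    have h1 := hsep u hu y hy (Ne.symm hyu)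
    have h2 := hsep v hv y hy (Ne.symm hyv)
    linarith
  have hle : ∀ y ∈ X, ⟪c₀, y⟫ ≤ 1 := by
    intro y hy
    by_cases hyu : y = u
    · rw [hyu, hc₀u]
    by_cases hyv : y = v
    · rw [hyv, hc₀v]
    exact (hlt y hy hyu hyv).le
  have htight : tightSet X c₀ = {u, v} := by
    ext y
    rw [mem_tightSet, Finset.mem_insert, Finset.mem_singleton]
    constructor
    · rintro ⟨hy, hy1⟩
      by_contra h'
      push Not at h'
      exact (hlt y hy h'.1 h'.2).ne hy1
    · rintro (rfl | rfl)
      · exact ⟨hu, hc₀u⟩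
      · exact ⟨hv, hc₀v⟩
  refine mem_hullEdges.2 ⟨c₀, ⟨hle, ?_⟩, htight⟩
  rw [htight, Finset.card_pair hne]

/-- **Soft bonds are hull edges** (family form): a family `B` of soft-bond pairs `{u, v} ⊆ X`
(`u ≠ v`, `cb ≤ ⟪u, v⟫`) is a sub-family of `hullEdges X`, in a window with `2 ca < 1 + cb`.
[folklore] -/
theorem subset_hullEdges_of_soft_bonds {X : Finset (EuclideanSpace ℝ (Fin 3))}
    (hX1 : ∀ y ∈ X, ‖y‖ = 1) {ca cb : ℝ} (hcb : -1 < cb) (h : 2 * ca < 1 + cb)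
    (hsep : ∀ u ∈ X, ∀ v ∈ X, u ≠ v → ⟪u, v⟫ ≤ ca)
    {B : Finset (Finset (EuclideanSpace ℝ (Fin 3)))}
    (hB : ∀ T ∈ B, ∃ u ∈ X, ∃ v ∈ X, u ≠ v ∧ cb ≤ ⟪u, v⟫ ∧ T = {u, v}) : B ⊆ hullEdges X := by
  intro T hT
  obtain ⟨u, hu, v, hv, hne, huv, rfl⟩ := hB T hT
  exact pair_mem_hullEdges_of_soft_bond hX1 hcb h hsep hu hv hne huv

/-- **At most `3N − 6` soft bonds** when `0` is interior to the hull: the edge bound of Euler's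
formula (`card_hullEdges_le`) for the soft link graph.  For twelve 4-regular link directions
(`24` bond pairs) this reads `24 ≤ #hullEdges X ≤ 30`: at most six hull edges are not bonds.
[folklore] -/
theorem card_soft_bonds_le {X : Finset (EuclideanSpace ℝ (Fin 3))} (hX1 : ∀ y ∈ X, ‖y‖ = 1)
    (h0 : (0 : EuclideanSpace ℝ (Fin 3)) ∈
      interior (convexHull ℝ (X : Set (EuclideanSpace ℝ (Fin 3)))))
    {ca cb : ℝ} (hcb : -1 < cb) (h : 2 * ca < 1 + cb)
    (hsep : ∀ u ∈ X, ∀ v ∈ X, u ≠ v → ⟪u, v⟫ ≤ ca)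
    {B : Finset (Finset (EuclideanSpace ℝ (Fin 3)))}
    (hB : ∀ T ∈ B, ∃ u ∈ X, ∃ v ∈ X, u ≠ v ∧ cb ≤ ⟪u, v⟫ ∧ T = {u, v}) :
    B.card + 6 ≤ 3 * X.card := by
  have h1 := Finset.card_le_card (subset_hullEdges_of_soft_bonds hX1 hcb h hsep hB)
  have h2 := card_hullEdges_le hX1 h0
  omega

/-- **`η = 1/100` instance**: in the angular window of `softFourRings_of_twelve_unit`
(`ca = 1 − 1/(2·(101/100)²)`, `cb = 1 − (101/100)²/2`) every soft bond of a set of unit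
directions spans a hull edge. [folklore] -/
theorem pair_mem_hullEdges_of_soft_bond_one_percent {X : Finset (EuclideanSpace ℝ (Fin 3))}
    (hX1 : ∀ y ∈ X, ‖y‖ = 1)
    (hsep : ∀ u ∈ X, ∀ v ∈ X, u ≠ v → ⟪u, v⟫ ≤ 1 - 1 / (2 * (101 / 100 : ℝ) ^ 2))
    {u v : EuclideanSpace ℝ (Fin 3)} (hu : u ∈ X) (hv : v ∈ X) (hne : u ≠ v)
    (huv : (1 - (101 / 100 : ℝ) ^ 2 / 2) ≤ ⟪u, v⟫) :
    ({u, v} : Finset (EuclideanSpace ℝ (Fin 3))) ∈ hullEdges X :=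
  pair_mem_hullEdges_of_soft_bond hX1 (cb := 1 - (101 / 100 : ℝ) ^ 2 / 2) (by norm_num)
    (by norm_num) hsep hu hv hne huv

end Summit.AtomisticToContinuum.Crystallization.Theorems
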